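import Summits.NavierStokesRegularity.NavierStokesRegularity.Theorems.OddMorawetzOddMorawetzLocalLiveReduction
import Summits.NavierStokesRegularity.NavierStokesRegularity.Theorems.OddMorawetzOddMorawetzLocalKernelEqSpan
import Summits.NavierStokesRegularity.NavierStokesRegularity.Theorems.OddMorawetzOddMorawetzLocalCertBridgeRows
import Summits.NavierStokesRegularity.NavierStokesRegularity.Theorems.OddMorawetzOddMorawetzLocalIsoTransfer
import Summits.NavierStokesRegularity.NavierStokesRegularity.Theorems.OddMorawetzOddMorawetzLocalCert5A1
import Summits.NavierStokesRegularity.NavierStokesRegularity.Theorems.OddMorawetzOddMorawetzLocalCert5A2a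
import Summits.NavierStokesRegularity.NavierStokesRegularity.Theorems.OddMorawetzOddMorawetzLocalCert5A2b
import Summits.NavierStokesRegularity.NavierStokesRegularity.Theorems.OddMorawetzOddMorawetzLocalCert5A3a
import Summits.NavierStokesRegularity.NavierStokesRegularity.Theorems.OddMorawetzOddMorawetzLocalCert5A3b
import Summits.NavierStokesRegularity.NavierStokesRegularity.Theorems.OddMorawetzOddMorawetzLocalCert5B1
import Summits.NavierStokesRegularity.NavierStokesRegularity.Theorems.OddMorawetzOddMorawetzLocalCert5B2
import Summits.NavierStokesRegularity.NavierStokesRegularity.Theorems.OddMorawetzOddMorawetzLocalCert5B3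
import Summits.NavierStokesRegularity.NavierStokesRegularity.Theorems.OddMorawetzOddMorawetzLocalCert5B4
import Summits.NavierStokesRegularity.NavierStokesRegularity.Theorems.OddMorawetzOddMorawetzLocalCert5B5
import Summits.NavierStokesRegularity.NavierStokesRegularity.Theorems.OddMorawetzOddMorawetzLocalCert5C1
import Summits.NavierStokesRegularity.NavierStokesRegularity.Theorems.OddMorawetzOddMorawetzLocalCert5C2
import Summits.NavierStokesRegularity.NavierStokesRegularity.Theorems.OddMorawetzOddMorawetzLocalCert5C3
import Summits.NavierStokesRegularity.NavierStokesRegularity.Theorems.OddMorawetzOddMorawetzLocalCert5D1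
import Summits.NavierStokesRegularity.NavierStokesRegularity.Theorems.OddMorawetzOddMorawetzLocalCert5D2
import Summits.NavierStokesRegularity.NavierStokesRegularity.Theorems.OddMorawetzOddMorawetzLocalCert5D3
import Summits.NavierStokesRegularity.NavierStokesRegularity.Theorems.OddMorawetzOddMorawetzLocalCert5E
import HarnessLib

/-!
# Crux `OddMorawetzLocal` (stmt-NavierStokesRegularity-1376) — weight 5: reduction to the two live densities

Instantiation of `live_reduction` with the weight-5 data (`reps5`, `isoDesc5`, `blocks5`, `kcols5`, `cinv5`, prime
8191) and its kernel certificates (`cert5_*`, all chunked for kernel memory): for an `O(3)`-fixed weight-5 coefficient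
vector `τ` there are reals `γ_A, γ_B` with `morawetzPairing 5 v τ = γ_A · Q_A(v) + γ_B · Q_B(v)` for every
divergence-free Schwartz field `v`, where `Q_A, Q_B` are the pairings of the live densities `isoPolyF isoDesc5[0]`,
`isoPolyF isoDesc5[1]` (the other 48 isotropic basis elements are divergences or ideal members).
Everything is proved; no definitions; no named facts.
-/

noncomputable section

set_option linter.dupNamespace false

namespace Summit.NavierStokesRegularity.NavierStokesRegularity.Theorems.OddMorawetz

open MeasureTheory Literature.Analysis.FluidPDE

/-- `8191` is prime (`2¹³ − 1`). -/
theorem certPrime5_prime : Nat.Prime certPrime5 := by unfold certPrime5; norm_num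

/-- A property checked on the chunks `((l.drop (c*j)).take c)` for all `j < ⌈|l|/c⌉` holds on all of `l`. -/
theorem forall_mem_of_chunks {α : Type*} (l : List α) (c : ℕ) (hc : 0 < c) (P : α → Prop)
    (h : ∀ j, j < (l.length + c - 1) / c → ∀ q ∈ (l.drop (c * j)).take c, P q) : ∀ q ∈ l, P q := by
  intro q hq
  obtain ⟨i, hi, rfl⟩ := List.getElem_of_mem hq
  have hQ : l.length ≤ (l.length + c - 1) / c * c := by
    have := Nat.lt_div_mul_add (a := l.length + c - 1) hc
    omega
  have h1 := Nat.div_add_mod i c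
  have h2 := Nat.mod_lt i hc
  refine h (i / c) ((Nat.div_lt_iff_lt_mul hc).2 (by omega)) _ ?_
  have hlt : i % c < ((l.drop (c * (i / c))).take c).length := by
    simp only [List.length_take, List.length_drop]
    omega
  have hmem := List.getElem_mem hlt
  simp only [List.getElem_take, List.getElem_drop] at hmem
  have hidx : c * (i / c) + i % c = i := h1
  simp only [hidx] at hmem
  exact hmem

/-- Descriptors `2 … 49` of the weight-5 isotropic basis are `null` or `ideal`. -/
theorem isoDesc5_kind (j : ℕ) (hj : 2 ≤ j) (hj' : j < 50) :
    (∃ sh mt, isoDesc5.getD j (.poly []) = IsoDesc.null sh mt) ∨ (∃ sh mt, isoDesc5.getD j (.poly []) = IsoDesc.ideal sh mt) := by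
  have hlen : isoDesc5.length = 50 := cert5_sizes.2.2.1
  have hmem : isoDesc5.getD j (.poly []) ∈ isoDesc5.drop 2 := by
    rw [List.getD_eq_getElem _ _ (by omega)]
    refine List.mem_iff_getElem.2 ⟨j - 2, by simp [hlen]; omega, ?_⟩
    rw [List.getElem_drop]
    congr 1
    omega
  have h := cert5_iso_kinds.1
  rw [List.all_eq_true] at h
  have hq := h _ hmem
  revert hq
  cases isoDesc5.getD j (.poly []) with
  | dens sh m => simp
  | null sh m => exact fun _ => Or.inl ⟨sh, m, rfl⟩
  | ideal sh m => exact fun _ => Or.inr ⟨sh, m, rfl⟩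
  | poly p => simp

/-- **Weight 5: the pairing of an `O(3)`-fixed coefficient vector is a combination of the pairings of the two live
densities.** -/
theorem weight_five_live (τ : V 5)
    (hfix : ∀ G ∈ Matrix.unitaryGroup (Fin 3) ℝ, (actMatrix 5 (G : Matrix (Fin 3) (Fin 3) ℝ)).mulVec τ = τ) :
    ∃ γA γB : ℝ, ∀ v, IsSchwartzField v → VectorCalculus.IsDivFree v →
      morawetzPairing 5 v τ =
        γA * morawetzPairing 5 v (fun i => ((vecOf 5 (isoPolyF (isoDesc5.getD 0 (.poly []))) i : ℤ) : ℝ)) +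
        γB * morawetzPairing 5 v (fun i => ((vecOf 5 (isoPolyF (isoDesc5.getD 1 (.poly []))) i : ℤ) : ℝ)) := by
  haveI : Fact (Nat.Prime certPrime5) := ⟨certPrime5_prime⟩
  obtain ⟨hidx, hreps, hiso, hblocks⟩ := cert5_sizes
  obtain ⟨hrows, -, hkc, hci⟩ := cert5_sizes'
  -- representatives are basis monomials
  have hr : ∀ m ∈ reps5, m ∈ idx 5 := by
    intro m hm
    exact mem_idx_of_canonical_check 5 _ cert5_reps_canonical ((1 : ℤ), m) (List.mem_map.2 ⟨m, hm, rfl⟩)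
  -- orbit-sum identities from the 46 e1Check chunks
  have he := he_of_e1Check_cover 5 reps5 (fun i hi => by
    rw [hidx] at hi
    have h46 : i / 100 < 46 := by omega
    interval_cases h : i / 100
    · exact ⟨0, 100, by omega, by omega, cert5_e1_0⟩
    · exact ⟨100, 100, by omega, by omega, cert5_e1_1⟩
    · exact ⟨200, 100, by omega, by omega, cert5_e1_2⟩
    · exact ⟨300, 100, by omega, by omega, cert5_e1_3⟩
    · exact ⟨400, 100, by omega, by omega, cert5_e1_4⟩
    · exact ⟨500, 100, by omega, by omega, cert5_e1_5⟩
    · exact ⟨600, 100, by omega, by omega, cert5_e1_6⟩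
    · exact ⟨700, 100, by omega, by omega, cert5_e1_7⟩
    · exact ⟨800, 100, by omega, by omega, cert5_e1_8⟩
    · exact ⟨900, 100, by omega, by omega, cert5_e1_9⟩
    · exact ⟨1000, 100, by omega, by omega, cert5_e1_10⟩
    · exact ⟨1100, 100, by omega, by omega, cert5_e1_11⟩
    · exact ⟨1200, 100, by omega, by omega, cert5_e1_12⟩
    · exact ⟨1300, 100, by omega, by omega, cert5_e1_13⟩
    · exact ⟨1400, 100, by omega, by omega, cert5_e1_14⟩
    · exact ⟨1500, 100, by omega, by omega, cert5_e1_15⟩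
    · exact ⟨1600, 100, by omega, by omega, cert5_e1_16⟩
    · exact ⟨1700, 100, by omega, by omega, cert5_e1_17⟩
    · exact ⟨1800, 100, by omega, by omega, cert5_e1_18⟩
    · exact ⟨1900, 100, by omega, by omega, cert5_e1_19⟩
    · exact ⟨2000, 100, by omega, by omega, cert5_e1_20⟩
    · exact ⟨2100, 100, by omega, by omega, cert5_e1_21⟩
    · exact ⟨2200, 100, by omega, by omega, cert5_e1_22⟩
    · exact ⟨2300, 100, by omega, by omega, cert5_e1_23⟩
    · exact ⟨2400, 100, by omega, by omega, cert5_e1_24⟩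
    · exact ⟨2500, 100, by omega, by omega, cert5_e1_25⟩
    · exact ⟨2600, 100, by omega, by omega, cert5_e1_26⟩
    · exact ⟨2700, 100, by omega, by omega, cert5_e1_27⟩
    · exact ⟨2800, 100, by omega, by omega, cert5_e1_28⟩
    · exact ⟨2900, 100, by omega, by omega, cert5_e1_29⟩
    · exact ⟨3000, 100, by omega, by omega, cert5_e1_30⟩
    · exact ⟨3100, 100, by omega, by omega, cert5_e1_31⟩
    · exact ⟨3200, 100, by omega, by omega, cert5_e1_32⟩
    · exact ⟨3300, 100, by omega, by omega, cert5_e1_33⟩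
    · exact ⟨3400, 100, by omega, by omega, cert5_e1_34⟩
    · exact ⟨3500, 100, by omega, by omega, cert5_e1_35⟩
    · exact ⟨3600, 100, by omega, by omega, cert5_e1_36⟩
    · exact ⟨3700, 100, by omega, by omega, cert5_e1_37⟩
    · exact ⟨3800, 100, by omega, by omega, cert5_e1_38⟩
    · exact ⟨3900, 100, by omega, by omega, cert5_e1_39⟩
    · exact ⟨4000, 100, by omega, by omega, cert5_e1_40⟩
    · exact ⟨4100, 100, by omega, by omega, cert5_e1_41⟩
    · exact ⟨4200, 100, by omega, by omega, cert5_e1_42⟩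
    · exact ⟨4300, 100, by omega, by omega, cert5_e1_43⟩
    · exact ⟨4400, 100, by omega, by omega, cert5_e1_44⟩
    · exact ⟨4500, 9, by omega, by omega, cert5_e1_45⟩)
  -- derivation kills / reconstruction of the isotropic basis (25 chunks of 2 each)
  have hder : ∀ q ∈ isoDesc5, derKillsF lieZ (isoPolyF q) = true := by
    refine forall_mem_of_chunks isoDesc5 2 (by norm_num) _ fun j hj q hq => ?_
    rw [hiso] at hj
    interval_cases j
    · have h := cert5_iso_der_0; rw [List.all_eq_true] at h; exact h q hq
    · have h := cert5_iso_der_1; rw [List.all_eq_true] at h; exact h q hq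
    · have h := cert5_iso_der_2; rw [List.all_eq_true] at h; exact h q hq
    · have h := cert5_iso_der_3; rw [List.all_eq_true] at h; exact h q hq
    · have h := cert5_iso_der_4; rw [List.all_eq_true] at h; exact h q hq
    · have h := cert5_iso_der_5; rw [List.all_eq_true] at h; exact h q hq
    · have h := cert5_iso_der_6; rw [List.all_eq_true] at h; exact h q hq
    · have h := cert5_iso_der_7; rw [List.all_eq_true] at h; exact h q hq
    · have h := cert5_iso_der_8; rw [List.all_eq_true] at h; exact h q hq
    · have h := cert5_iso_der_9; rw [List.all_eq_true] at h; exact h q hq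
    · have h := cert5_iso_der_10; rw [List.all_eq_true] at h; exact h q hq
    · have h := cert5_iso_der_11; rw [List.all_eq_true] at h; exact h q hq
    · have h := cert5_iso_der_12; rw [List.all_eq_true] at h; exact h q hq
    · have h := cert5_iso_der_13; rw [List.all_eq_true] at h; exact h q hq
    · have h := cert5_iso_der_14; rw [List.all_eq_true] at h; exact h q hq
    · have h := cert5_iso_der_15; rw [List.all_eq_true] at h; exact h q hq
    · have h := cert5_iso_der_16; rw [List.all_eq_true] at h; exact h q hq
    · have h := cert5_iso_der_17; rw [List.all_eq_true] at h; exact h q hq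
    · have h := cert5_iso_der_18; rw [List.all_eq_true] at h; exact h q hq
    · have h := cert5_iso_der_19; rw [List.all_eq_true] at h; exact h q hq
    · have h := cert5_iso_der_20; rw [List.all_eq_true] at h; exact h q hq
    · have h := cert5_iso_der_21; rw [List.all_eq_true] at h; exact h q hq
    · have h := cert5_iso_der_22; rw [List.all_eq_true] at h; exact h q hq
    · have h := cert5_iso_der_23; rw [List.all_eq_true] at h; exact h q hq
    · have h := cert5_iso_der_24; rw [List.all_eq_true] at h; exact h q hq
  have hrec : ∀ q ∈ isoDesc5, orbitReconF reps5 (isoPolyF q) = true := by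
    refine forall_mem_of_chunks isoDesc5 2 (by norm_num) _ fun j hj q hq => ?_
    rw [hiso] at hj
    interval_cases j
    · have h := cert5_iso_recon_0; rw [List.all_eq_true] at h; exact h q hq
    · have h := cert5_iso_recon_1; rw [List.all_eq_true] at h; exact h q hq
    · have h := cert5_iso_recon_2; rw [List.all_eq_true] at h; exact h q hq
    · have h := cert5_iso_recon_3; rw [List.all_eq_true] at h; exact h q hq
    · have h := cert5_iso_recon_4; rw [List.all_eq_true] at h; exact h q hq
    · have h := cert5_iso_recon_5; rw [List.all_eq_true] at h; exact h q hq
    · have h := cert5_iso_recon_6; rw [List.all_eq_true] at h; exact h q hq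
    · have h := cert5_iso_recon_7; rw [List.all_eq_true] at h; exact h q hq
    · have h := cert5_iso_recon_8; rw [List.all_eq_true] at h; exact h q hq
    · have h := cert5_iso_recon_9; rw [List.all_eq_true] at h; exact h q hq
    · have h := cert5_iso_recon_10; rw [List.all_eq_true] at h; exact h q hq
    · have h := cert5_iso_recon_11; rw [List.all_eq_true] at h; exact h q hq
    · have h := cert5_iso_recon_12; rw [List.all_eq_true] at h; exact h q hq
    · have h := cert5_iso_recon_13; rw [List.all_eq_true] at h; exact h q hq
    · have h := cert5_iso_recon_14; rw [List.all_eq_true] at h; exact h q hq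
    · have h := cert5_iso_recon_15; rw [List.all_eq_true] at h; exact h q hq
    · have h := cert5_iso_recon_16; rw [List.all_eq_true] at h; exact h q hq
    · have h := cert5_iso_recon_17; rw [List.all_eq_true] at h; exact h q hq
    · have h := cert5_iso_recon_18; rw [List.all_eq_true] at h; exact h q hq
    · have h := cert5_iso_recon_19; rw [List.all_eq_true] at h; exact h q hq
    · have h := cert5_iso_recon_20; rw [List.all_eq_true] at h; exact h q hq
    · have h := cert5_iso_recon_21; rw [List.all_eq_true] at h; exact h q hq
    · have h := cert5_iso_recon_22; rw [List.all_eq_true] at h; exact h q hq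
    · have h := cert5_iso_recon_23; rw [List.all_eq_true] at h; exact h q hq
    · have h := cert5_iso_recon_24; rw [List.all_eq_true] at h; exact h q hq
  -- the certified kernel of the derivation system (row-chunked certificates)
  have hI : 0 < (idx 5).length := by rw [hidx]; norm_num
  have hJ : 0 < reps5.length := by rw [hreps]; norm_num
  have hblk : ∀ β, β < blocks5.length → ∀ a, a < (blocks5.getD β ([], [], [])).1.length →
      ∃ lo n, lo ≤ a ∧ a < lo + n ∧
        blockCheckRows 5 lieZ reps5 (blocks5.getD β ([], [], [])).1 (blocks5.getD β ([], [], [])).2.1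
          (blocks5.getD β ([], [], [])).2.2 certPrime5 lo n = true := by
    intro β hβ a ha
    rw [hblocks] at hβ
    interval_cases β
    · have hsz : (blocks5.getD 0 ([], [], [])).1.length = 53 := by decide +kernel
      rw [hsz] at ha
      have h7 : a / 8 < 7 := by omega
      interval_cases h : a / 8
      · exact ⟨0, 8, by omega, by omega, cert5_blockRows_0_0⟩
      · exact ⟨8, 8, by omega, by omega, cert5_blockRows_0_1⟩
      · exact ⟨16, 8, by omega, by omega, cert5_blockRows_0_2⟩
      · exact ⟨24, 8, by omega, by omega, cert5_blockRows_0_3⟩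
      · exact ⟨32, 8, by omega, by omega, cert5_blockRows_0_4⟩
      · exact ⟨40, 8, by omega, by omega, cert5_blockRows_0_5⟩
      · exact ⟨48, 5, by omega, by omega, cert5_blockRows_0_6⟩
    · have hsz : (blocks5.getD 1 ([], [], [])).1.length = 45 := by decide +kernel
      rw [hsz] at ha
      have h6 : a / 8 < 6 := by omega
      interval_cases h : a / 8
      · exact ⟨0, 8, by omega, by omega, cert5_blockRows_1_0⟩
      · exact ⟨8, 8, by omega, by omega, cert5_blockRows_1_1⟩
      · exact ⟨16, 8, by omega, by omega, cert5_blockRows_1_2⟩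
      · exact ⟨24, 8, by omega, by omega, cert5_blockRows_1_3⟩
      · exact ⟨32, 8, by omega, by omega, cert5_blockRows_1_4⟩
      · exact ⟨40, 5, by omega, by omega, cert5_blockRows_1_5⟩
    · have hsz : (blocks5.getD 2 ([], [], [])).1.length = 49 := by decide +kernel
      rw [hsz] at ha
      have h7 : a / 8 < 7 := by omega
      interval_cases h : a / 8
      · exact ⟨0, 8, by omega, by omega, cert5_blockRows_2_0⟩
      · exact ⟨8, 8, by omega, by omega, cert5_blockRows_2_1⟩
      · exact ⟨16, 8, by omega, by omega, cert5_blockRows_2_2⟩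
      · exact ⟨24, 8, by omega, by omega, cert5_blockRows_2_3⟩
      · exact ⟨32, 8, by omega, by omega, cert5_blockRows_2_4⟩
      · exact ⟨40, 8, by omega, by omega, cert5_blockRows_2_5⟩
      · exact ⟨48, 1, by omega, by omega, cert5_blockRows_2_6⟩
  have hB := certB_mul_eq_one_of_rows 5 reps5 blocks5 kcols5 cinv5 50 certPrime5 147 hblk cert5_disjoint cert5_shape
    cert5_ranges hrows hI hJ
  have hS := (iso_transfer 5 reps5 isoDesc5 50 hiso hder hrec).1
  have hcert : ∀ l, l < 50 → ∃ lo n, lo ≤ l ∧ l < lo + n ∧ isoCertCheckRows reps5 isoDesc5 kcols5 cinv5 certPrime5 lo n = true := by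
    intro l hl
    have h17 : l / 3 < 17 := by omega
    interval_cases h : l / 3
    · exact ⟨0, 3, by omega, by omega, cert5_isoRows_0⟩
    · exact ⟨3, 3, by omega, by omega, cert5_isoRows_1⟩
    · exact ⟨6, 3, by omega, by omega, cert5_isoRows_2⟩
    · exact ⟨9, 3, by omega, by omega, cert5_isoRows_3⟩
    · exact ⟨12, 3, by omega, by omega, cert5_isoRows_4⟩
    · exact ⟨15, 3, by omega, by omega, cert5_isoRows_5⟩
    · exact ⟨18, 3, by omega, by omega, cert5_isoRows_6⟩
    · exact ⟨21, 3, by omega, by omega, cert5_isoRows_7⟩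
    · exact ⟨24, 3, by omega, by omega, cert5_isoRows_8⟩
    · exact ⟨27, 3, by omega, by omega, cert5_isoRows_9⟩
    · exact ⟨30, 3, by omega, by omega, cert5_isoRows_10⟩
    · exact ⟨33, 3, by omega, by omega, cert5_isoRows_11⟩
    · exact ⟨36, 3, by omega, by omega, cert5_isoRows_12⟩
    · exact ⟨39, 3, by omega, by omega, cert5_isoRows_13⟩
    · exact ⟨42, 3, by omega, by omega, cert5_isoRows_14⟩
    · exact ⟨45, 3, by omega, by omega, cert5_isoRows_15⟩
    · exact ⟨48, 2, by omega, by omega, cert5_isoRows_16⟩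
  have hC := isoCert_mul_eq_one_of_rows 5 reps5 blocks5 isoDesc5 kcols5 cinv5 50 certPrime5 hcert cert5_ranges hiso hJ
  have hcard : 147 + 50 = Fintype.card (Fin reps5.length) := by rw [Fintype.card_fin, hreps]
  have hker := kernel_eq_span_of_modular_certificate certPrime5 (aMatrix 5 reps5)
    (certIdx (certRows blocks5) (idx 5).length 147 hI) (certIdx (certCols blocks5) reps5.length 147 hJ)
    (certBd blocks5 certPrime5 147) hB (sVecD reps5 isoDesc5 50) hS (certIdx kcols5 reps5.length 50 hJ)
    (certCd cinv5 certPrime5 50) hC hcard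
  -- descriptor facts
  have hcan : ∀ q ∈ isoDesc5, ∀ t ∈ isoPolyF q, t.2 ∈ idx 5 := by
    refine forall_mem_of_chunks isoDesc5 10 (by norm_num) _ fun j hj q hq => ?_
    rw [hiso] at hj
    interval_cases j
    · have h := cert5_iso_canonical_0; rw [List.all_eq_true] at h; exact mem_idx_of_canonical_check 5 (isoPolyF q) (h q hq)
    · have h := cert5_iso_canonical_1; rw [List.all_eq_true] at h; exact mem_idx_of_canonical_check 5 (isoPolyF q) (h q hq)
    · have h := cert5_iso_canonical_2; rw [List.all_eq_true] at h; exact mem_idx_of_canonical_check 5 (isoPolyF q) (h q hq)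
    · have h := cert5_iso_canonical_3; rw [List.all_eq_true] at h; exact mem_idx_of_canonical_check 5 (isoPolyF q) (h q hq)
    · have h := cert5_iso_canonical_4; rw [List.all_eq_true] at h; exact mem_idx_of_canonical_check 5 (isoPolyF q) (h q hq)
  have hflux : ∀ sh mt, IsoDesc.null sh mt ∈ isoDesc5 →
      ∀ F ∈ [isoFlux sh mt 0, isoFlux sh mt 1, isoFlux sh mt 2], ∀ t ∈ F, ∀ u ∈ t.2, u.2.length ≤ 3 := by
    intro sh mt hq F hF t ht u hu
    have h := cert5_iso_fluxord
    rw [List.all_eq_true] at h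
    have h1 := h _ hq
    simp only [List.all_eq_true, decide_eq_true_eq] at h1
    exact h1 F hF t ht u hu
  have hideal : ∀ sh mt, IsoDesc.ideal sh mt ∈ isoDesc5 → nfKillsF (isoPolyF (.ideal sh mt)) = true := by
    intro sh mt hq
    have h := cert5_iso_ideal
    rw [List.all_eq_true] at h
    exact h _ hq
  obtain ⟨γ, hγ⟩ := live_reduction 5 τ hfix reps5 hr he isoDesc5 50 hiso hrec hker 2
    (fun j hj hj' => isoDesc5_kind j hj hj') hcan hflux hideal
  refine ⟨γ 0, γ 1, fun v hv hdv => ?_⟩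
  rw [hγ v hv hdv, Fin.sum_univ_succ, Fin.sum_univ_succ]
  simp only [Fin.val_zero, Fin.val_succ, show (0 : ℕ) < 2 from by norm_num, show (0 + 1 : ℕ) < 2 from by norm_num, if_true]
  have htail : ∀ l : Fin 48, ¬ ((l : ℕ) + 1 + 1 < 2) := fun l => by omega
  simp only [htail, if_false, Finset.sum_const_zero, add_zero]
  rfl

end Summit.NavierStokesRegularity.NavierStokesRegularity.Theorems.OddMorawetz

end
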